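import Summits.QuantumFields.BalabanUV.Beta.GAN24.FineReadoutSum
import Summits.QuantumFields.BalabanUV.Beta.GAN24.StripRegularPackaging
import Summits.QuantumFields.BalabanUV.Beta.GAN24.FibreDetStripHolds

/-!
# `BalabanUV.Beta.GAN24.FineReadoutDecay` — binder row G-an2-4 / (CONV-C), S-slot located remainder «E3Shape», route «S3-fibre²»
# (gan24-p1 `SKELETON-S3.md` v0.3 §8, RATIFIED method of record for S3-L1∕(S3-1) = «(U2′) explicit-alias», node E3A4 of
# `HOME/b2b-balaban-gan24-formalise-leaf-16/g8/E3A-READOUT.md` §2(g)): THE PACKAGING — (U2′) ⇒ `StripRegular` of the fine minimiser entry ⇒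
# Paley–Wiener ⇒ leaf-18's (N1): the `j`-UNIFORM POINTWISE BOUND OF BAŁABAN's MINIMISER `ℋ` WITH DECAY ON THE BLOCK SCALE, d = 3 UNCONDITIONAL

NOT IN PRINT; OUR PROOF ATTEMPT (of the road; THIS file is [folklore] packaging: E3A3(c) `FineReadoutSum.norm_fibInv_inl_inr_le` fed into leaf-06's
`StripRegularPackaging.stripRegular_fibInv`, pv17's `B4ContourShift.latticeKernel_decay` and gan24-p1's `CombesThomasFibre.wH_eq_re_latticeKernel`; at `d = 3`
the inputs (U1)+A are leaf-09's `FibreDetStripHolds.exists_strip` BY NAME).  HONEST FRAMING (cell contract, verbatim): «discharging `BetaPertH` makes Bałaban's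
UV stability UNCONDITIONAL — a real constructive-QFT result; it is NOT the continuum limit and NOT the Clay problem.»  HONEST DEPENDENCY (verbatim): «continuum
YM on T⁴ ⇐ BetaPertH ∧ nine spine estimates (0/9 proved); BetaPertH ⇐ (D1) ∧ (D4) ∧ CAP+tail; G-an2-4 gates asym, D1 and NE2/3/4.»  No cited fact, no wall
binder, no `def … : Prop`; discharges NOTHING of (hS, hSall) / «E3Shape» — (N1) is ONE of the three legs of ONE channel of the located statement; NOT `BetaPertH`,
NOT continuum, NOT Clay.

## What is proved
* §1 (generic `d`, `D = d+1`) `fineM` (the N-dependent sup bound of E3A3(c) at radius envelope `R₀`), `norm_fibInv_inl_inr_le_fineM` (monotonicity in `r₀ ≤ R₀`),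
  **`stripRegular_fibInv_inl_inr`**: a det-free strip of half-width `κ₀` (`0 < κ₀ ≤ 1/4`, `(3D/2+2)κ₀ ≤ 1/2`) carrying at every point a scaled a-priori pair with
  constant `A` and border radius `r₀ ≤ R₀` ⇒ `StripRegular (fibInv N (inl (κ,z)) (inr (inr l))) κ₀ (fineM …)`; **`abs_wH_le`**: then
  `|wH κ l z| ≤ fineM · e^{−κ₀‖quo N z‖∞}` for every fine `z` — the block `quo N z` of the fine site carries the decay.
* §2 (`d = 3`, every blocking factor `Lc ≥ 1`, `N = Lc^(j+1)`) **`exists_wH_decay`**: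
  `∃ κ₀ C, 0 < κ₀ ∧ 0 ≤ C ∧ ∀ j κ l z, |wH (N := Lc^(j+1)) κ l z| ≤ C · ((Lc^(j+1) : ℝ)^5)⁻¹ · e^{−κ₀‖quo (Lc^(j+1)) z‖∞}` — leaf-18's (N1)
  `|M^{d+1}·wH_M(f − M•y)| ≤ h·M⁻¹·e^{−δ|f/M − y|}` for ALL levels `M = Lc^(j+1)` with ONE `(κ₀, C)`, UNCONDITIONALLY (road P1's (U1)+A BY NAME).
Unit `b2b-balaban-gan24-formalise-leaf-16` (G-an2-4 formalisation swarm, leaf prover 16, gen 8; records — idle-seat engine), 2026-08-20.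
-/

noncomputable section

open Complex Finset Matrix
open scoped BigOperators Real Matrix.Norms.L2Operator
open Literature.Probability.LatticeModels (TorusSite Torus.proj)
open Literature.MathematicalPhysics.QuantumFieldTheory.LatticeForm (quo)
open Literature.MathematicalPhysics.QuantumFieldTheory.Balaban1983to89
open Literature.MathematicalPhysics.QuantumFieldTheory.Balaban1983to89.Beta
open Literature.MathematicalPhysics.QuantumFieldTheory.King1986 (aliasConst)
open B4Strip (Strip reVec)
open B4ContourShift (BZ StripRegular latticeKernel supNorm latticeKernel_decay)
open BlochFibreMatrix (Idx stencil pieceMatrix)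
open FibreInverseDecay (trigPolySymbol)
open KernelSpecInstance (wH)
open Summit.QuantumFields.BalabanUV.Beta.GAN24.ArrowOperator (arrowMat)
open Summit.QuantumFields.BalabanUV.Beta.GAN24.ArrowScaling (scaledArrow innerArrow outerArrow radI radO radI_pos radO_pos)
open Summit.QuantumFields.BalabanUV.Beta.GAN24.StripLegApriori (radO_zero_le_two_pi)
open Summit.QuantumFields.BalabanUV.Beta.GAN24.CombesThomasFibre (fibInv wH_eq_re_latticeKernel)
open Summit.QuantumFields.BalabanUV.Beta.GAN24.StripRegularPackaging (stripRegular_fibInv)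
open Summit.QuantumFields.BalabanUV.Beta.GAN24.FibreDetStripHolds (exists_strip strip_mono)
open Summit.QuantumFields.BalabanUV.Beta.GAN24.FineReadoutSum (norm_fibInv_inl_inr_le)

namespace Summit.QuantumFields.BalabanUV.Beta.GAN24.FineReadoutDecay

/-! ## §1 Packaging at generic `d` -/

section Generic

variable {d N : ℕ} [NeZero N]

/-- [folklore] The King constants of E3A3(c) at border-radius envelope `R₀`: `1 + K_D·(R₀²·C₁ + R₀³·C₂)`, `D = d+1`. -/
def kingFactor (d : ℕ) (R0 : ℝ) : ℝ :=
  1 + (Real.sqrt 12 ^ (d + 1) * (Real.sqrt 6 * (1 + 8 * (d + 1 : ℕ)))) *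
    (R0 ^ 2 * ((3 * π) ^ (1 - (-1 : ℝ)) * (3 : ℝ) ^ (d + 1) * aliasConst (d + 1) (-1))
      + R0 ^ 3 * ((3 * π) ^ (1 - (-2 : ℝ)) * (3 : ℝ) ^ (d + 1) * aliasConst (d + 1) (-2)))

/-- [folklore] THE SUP BOUND of the fine minimiser entry at block side `N`: `fineM = e^{(d+1)κ₀}·A·(N^{d+2})⁻¹·kingFactor d R₀`. -/
def fineM (d N : ℕ) (κ₀ A R0 : ℝ) : ℝ := Real.exp ((d + 1) * κ₀) * A * ((N : ℝ) ^ (d + 1 + 1))⁻¹ * kingFactor d R0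

/-- [folklore] King's constant is nonnegative for `α < 1`, `d ≥ 1` (it bounds a nonnegative sum). -/
theorem aliasConst_nonneg {D : ℕ} (hD : 0 < D) {α : ℝ} (hα : α < 1) : 0 ≤ aliasConst D α :=
  (Finset.sum_nonneg fun j _ => Literature.MathematicalPhysics.QuantumFieldTheory.King1986.aliasTerm_nonneg α _ j).trans
    (Literature.MathematicalPhysics.QuantumFieldTheory.King1986.alias_sum_le hD hα (p := fun _ => 0)
      (fun μ => by rw [abs_zero]; exact Real.pi_pos.le) 0)

/-- [folklore] `kingFactor` is monotone in the radius envelope on `[0, ∞)` and `≥ 1`. -/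
theorem kingFactor_mono {R0 R0' : ℝ} (h0 : 0 ≤ R0) (h : R0 ≤ R0') : kingFactor d R0 ≤ kingFactor d R0' := by
  unfold kingFactor
  have hC1 : 0 ≤ (3 * π) ^ (1 - (-1 : ℝ)) * (3 : ℝ) ^ (d + 1) * aliasConst (d + 1) (-1) :=
    mul_nonneg (by positivity) (aliasConst_nonneg (Nat.succ_pos d) (by norm_num))
  have hC2 : 0 ≤ (3 * π) ^ (1 - (-2 : ℝ)) * (3 : ℝ) ^ (d + 1) * aliasConst (d + 1) (-2) :=
    mul_nonneg (by positivity) (aliasConst_nonneg (Nat.succ_pos d) (by norm_num))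
  have h2 : R0 ^ 2 ≤ R0' ^ 2 := pow_le_pow_left₀ h0 h 2
  have h3 : R0 ^ 3 ≤ R0' ^ 3 := pow_le_pow_left₀ h0 h 3
  have hK : 0 ≤ Real.sqrt 12 ^ (d + 1) * (Real.sqrt 6 * (1 + 8 * (d + 1 : ℕ))) := by positivity
  nlinarith [mul_le_mul_of_nonneg_right h2 hC1, mul_le_mul_of_nonneg_right h3 hC2]

/-- [folklore] `1 ≤ kingFactor d R₀` for `R₀ ≥ 0`. -/
theorem one_le_kingFactor {R0 : ℝ} (h0 : 0 ≤ R0) : 1 ≤ kingFactor d R0 := by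
  unfold kingFactor
  have hC1 : 0 ≤ (3 * π) ^ (1 - (-1 : ℝ)) * (3 : ℝ) ^ (d + 1) * aliasConst (d + 1) (-1) :=
    mul_nonneg (by positivity) (aliasConst_nonneg (Nat.succ_pos d) (by norm_num))
  have hC2 : 0 ≤ (3 * π) ^ (1 - (-2 : ℝ)) * (3 : ℝ) ^ (d + 1) * aliasConst (d + 1) (-2) :=
    mul_nonneg (by positivity) (aliasConst_nonneg (Nat.succ_pos d) (by norm_num))
  have : 0 ≤ (Real.sqrt 12 ^ (d + 1) * (Real.sqrt 6 * (1 + 8 * (d + 1 : ℕ)))) *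
      (R0 ^ 2 * ((3 * π) ^ (1 - (-1 : ℝ)) * (3 : ℝ) ^ (d + 1) * aliasConst (d + 1) (-1))
        + R0 ^ 3 * ((3 * π) ^ (1 - (-2 : ℝ)) * (3 : ℝ) ^ (d + 1) * aliasConst (d + 1) (-2))) := by positivity
  linarith

omit [NeZero N] in
/-- [folklore] `0 ≤ fineM`. -/
theorem fineM_nonneg {κ₀ A R0 : ℝ} (hA : 0 ≤ A) (hR0 : 0 ≤ R0) : 0 ≤ fineM d N κ₀ A R0 := by
  unfold fineM
  have := one_le_kingFactor (d := d) hR0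
  positivity

/-- [folklore] (U2′) AT A STRIP POINT WITH A SCALED A-PRIORI PAIR OF BORDER RADIUS `r₀ ≤ R₀`: `‖fibInv N (inl (κ,z)) (inr (inr l)) p‖ ≤ fineM d N κ₀ A R₀`. -/
theorem norm_fibInv_inl_inr_le_fineM {κ₀ A R0 : ℝ} (hκ : 0 ≤ κ₀) (hκ4 : κ₀ ≤ 1 / 4) (hκD : (3 * (d + 1 : ℕ) / 2 + 2) * κ₀ ≤ 1 / 2) (hA : 0 ≤ A)
    {p : Fin (d + 1) → ℂ} (hp : p ∈ Strip (d + 1) κ₀) (hdet : (trigPolySymbol (stencil (d + 1)) (pieceMatrix (N := N)) p).det ≠ 0)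
    {r : TorusSite (d + 1) N → ℝ} (hr : ∀ m, 0 < r m) {r0 : ℝ} (hr0 : 0 < r0) (hr0R : r0 ≤ R0)
    (hU : IsUnit (arrowMat (scaledArrow N r r0 p))) (hAi : ‖(arrowMat (scaledArrow N r r0 p))⁻¹‖ ≤ A)
    (l κ : Fin (d + 1)) (z : TorusSite (d + 1) N) :
    ‖fibInv N (Sum.inl (κ, z)) (Sum.inr (Sum.inr l)) p‖ ≤ fineM d N κ₀ A R0 := by
  have h := norm_fibInv_inl_inr_le (fun i => (hp i).1) (fun i => (hp i).2) hκ hκ4 hκD hdet hr hr0 hA hU hAi l κ z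
  refine h.trans ?_
  unfold fineM
  have hK := kingFactor_mono (d := d) hr0.le hr0R
  have hE : 0 ≤ Real.exp ((d + 1) * κ₀) * A * ((N : ℝ) ^ (d + 1 + 1))⁻¹ := by positivity
  exact mul_le_mul_of_nonneg_left hK hE

/-- [folklore] **`StripRegular` OF THE FINE MINIMISER ENTRY** from a det-free strip carrying scaled a-priori pairs (inner or outer, border radius `≤ R₀`). -/
theorem stripRegular_fibInv_inl_inr {κ₀ A R0 : ℝ} (hκ0 : 0 < κ₀) (hκ4 : κ₀ ≤ 1 / 4) (hκD : (3 * (d + 1 : ℕ) / 2 + 2) * κ₀ ≤ 1 / 2)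
    (hA : 0 ≤ A) (_hR0 : 0 < R0)
    (hdet : ∀ p ∈ Strip (d + 1) κ₀, (trigPolySymbol (stencil (d + 1)) (pieceMatrix (N := N)) p).det ≠ 0)
    (hpair : ∀ p ∈ Strip (d + 1) κ₀, ∃ (r : TorusSite (d + 1) N → ℝ) (r0 : ℝ), (∀ m, 0 < r m) ∧ 0 < r0 ∧ r0 ≤ R0 ∧
      IsUnit (arrowMat (scaledArrow N r r0 p)) ∧ ‖(arrowMat (scaledArrow N r r0 p))⁻¹‖ ≤ A)
    (l κ : Fin (d + 1)) (z : TorusSite (d + 1) N) :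
    StripRegular (fibInv N (Sum.inl (κ, z)) (Sum.inr (Sum.inr l))) κ₀ (fineM d N κ₀ A R0) := by
  refine stripRegular_fibInv hκ0.le hdet _ _ fun p hp => ?_
  obtain ⟨r, r0, hr, hr0, hr0R, hU, hAi⟩ := hpair p hp
  exact norm_fibInv_inl_inr_le_fineM hκ0.le hκ4 hκD hA hp (hdet p hp) hr hr0 hr0R hU hAi l κ z

/-- [folklore] **(N1) AT BLOCK SIDE `N`**: Paley–Wiener on the block label — `|wH κ l z| ≤ fineM · e^{−κ₀‖quo N z‖∞}` for EVERY fine bond `(κ, z)`. -/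
theorem abs_wH_le {κ₀ A R0 : ℝ} (hκ0 : 0 < κ₀) (hκ4 : κ₀ ≤ 1 / 4) (hκD : (3 * (d + 1 : ℕ) / 2 + 2) * κ₀ ≤ 1 / 2)
    (hA : 0 ≤ A) (hR0 : 0 < R0)
    (hdet : ∀ p ∈ Strip (d + 1) κ₀, (trigPolySymbol (stencil (d + 1)) (pieceMatrix (N := N)) p).det ≠ 0)
    (hpair : ∀ p ∈ Strip (d + 1) κ₀, ∃ (r : TorusSite (d + 1) N → ℝ) (r0 : ℝ), (∀ m, 0 < r m) ∧ 0 < r0 ∧ r0 ≤ R0 ∧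
      IsUnit (arrowMat (scaledArrow N r r0 p)) ∧ ‖(arrowMat (scaledArrow N r r0 p))⁻¹‖ ≤ A)
    (κ l : Fin (d + 1)) (z : Fin (d + 1) → ℤ) :
    |wH (N := N) κ l z| ≤ fineM d N κ₀ A R0 * Real.exp (-(κ₀ * supNorm (quo N z))) := by
  rw [wH_eq_re_latticeKernel]
  refine (Complex.abs_re_le_norm _).trans ?_
  exact latticeKernel_decay (stripRegular_fibInv_inl_inr hκ0 hκ4 hκD hA hR0 hdet hpair l κ (Torus.proj N z)) hκ0.le _

end Generic

/-! ## §2 `d = 3`: (N1) for every level, unconditionally, from road P1's (U1)+A -/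

section Four

variable {Lc : ℕ} [NeZero Lc]

/-- [folklore] **leaf-18's (N1), UNCONDITIONAL AT d = 3**: ONE rate `κ₀ > 0` and ONE constant `C` such that for EVERY level `N = Lc^(j+1)` and every fine bond,
`|wH (N := Lc^(j+1)) κ l z| ≤ C · ((Lc^(j+1))^5)⁻¹ · e^{−κ₀‖quo (Lc^(j+1)) z‖∞}` — the fine minimiser column of Bałaban's `U = 1` block-spin map is
`O(N^{−(d+2)})` pointwise with exponential decay on the BLOCK scale, uniformly in the level (inputs: leaf-09's `FibreDetStripHolds.exists_strip` BY NAME). -/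
theorem exists_wH_decay :
    ∃ κ₀ C : ℝ, 0 < κ₀ ∧ 0 ≤ C ∧ ∀ (j : ℕ) (κ l : Fin 4) (z : Fin 4 → ℤ),
      |wH (N := Lc ^ (j + 1)) κ l z| ≤ C * (((Lc ^ (j + 1) : ℕ) : ℝ) ^ 5)⁻¹ * Real.exp (-(κ₀ * supNorm (quo (Lc ^ (j + 1)) z))) := by
  obtain ⟨ρ₀, κ₀, A, hρ₀, hκ₀, _hκρ, hκ4, hA, hdet, hpair⟩ := exists_strip (d := 3) (Lc := Lc)
  -- shrink the strip so that E3A2's relative bound applies: (3·4/2 + 2)·κ₁ ≤ 1/2, i.e. κ₁ ≤ 1/16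
  set κ₁ : ℝ := min κ₀ (1 / 16) with hκ₁
  have hκ₁0 : 0 < κ₁ := lt_min hκ₀ (by norm_num)
  have hκ₁le : κ₁ ≤ κ₀ := min_le_left _ _
  have hκ₁4 : κ₁ ≤ 1 / 4 := (min_le_right _ _).trans (by norm_num)
  have hκ₁D : (3 * (3 + 1 : ℕ) / 2 + 2) * κ₁ ≤ 1 / 2 := by
    have := min_le_right κ₀ (1 / 16 : ℝ); push_cast; nlinarith
  set R0 : ℝ := 2 * π with hR0
  have hR0pos : 0 < R0 := by rw [hR0]; positivity
  refine ⟨κ₁, Real.exp ((3 + 1) * κ₁) * A * kingFactor 3 R0, hκ₁0, ?_, fun j κ l z => ?_⟩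
  · have := one_le_kingFactor (d := 3) hR0pos.le; positivity
  haveI : NeZero (Lc ^ (j + 1)) := ⟨pow_ne_zero _ (NeZero.ne Lc)⟩
  have hdet₁ : ∀ p ∈ Strip (3 + 1) κ₁, (trigPolySymbol (stencil (3 + 1)) (pieceMatrix (N := Lc ^ (j + 1))) p).det ≠ 0 :=
    strip_mono hκ₁le (hdet j)
  have hpair₁ : ∀ p ∈ Strip (3 + 1) κ₁, ∃ (r : TorusSite (3 + 1) (Lc ^ (j + 1)) → ℝ) (r0 : ℝ), (∀ m, 0 < r m) ∧ 0 < r0 ∧ r0 ≤ R0 ∧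
      IsUnit (arrowMat (scaledArrow (Lc ^ (j + 1)) r r0 p)) ∧ ‖(arrowMat (scaledArrow (Lc ^ (j + 1)) r r0 p))⁻¹‖ ≤ A := by
    intro p hp
    have hq : ∀ i, |reVec p i| ≤ π := fun i => (hp i).1
    rcases strip_mono hκ₁le (hpair j) p hp with ⟨_, hU, hAi⟩ | ⟨_, _, hq0, hU, hAi⟩
    · refine ⟨radI (Lc ^ (j + 1)), 1, radI_pos, one_pos, ?_, hU, hAi⟩
      rw [hR0]; have := Real.pi_gt_three; linarith
    · exact ⟨radO (Lc ^ (j + 1)) (reVec p), radO (Lc ^ (j + 1)) (reVec p) 0, radO_pos hq hq0, radO_pos hq hq0 0,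
        radO_zero_le_two_pi hq, hU, hAi⟩
  have h := abs_wH_le (N := Lc ^ (j + 1)) hκ₁0 hκ₁4 hκ₁D hA hR0pos hdet₁ hpair₁ κ l z
  refine h.trans (le_of_eq ?_)
  unfold fineM
  push_cast
  ring

end Four

end Summit.QuantumFields.BalabanUV.Beta.GAN24.FineReadoutDecay

end
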